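import Mathlib
import Summits.NavierStokesRegularity.NavierStokesRegularity.Theorems.EulerZoomLiouvillePowerGaugeEulerLiouvilleEnergySaturationLoc
import HarnessLib

/-!
# Energy saturation on the crux `EulerZoomLiouville.PowerGaugeEulerLiouville` — OWN-RATE BOOTSTRAP for the residual clock rates `g ∈ [2/5, 1/(2+ρ)]`:
# the two pure-real steps (from the left to the own-rate floor; from infinity under own-rate sub-extremality) and their iteration
# (crux = stmt-NavierStokesRegularity-19832, route №10 `EulerZoomLiouville`; line `logtime-breathers`, residue T4 `stub_powerClockRest`)

Width seat `ns-ezl-w6` (cell ns-regularity-ideate, LEAD ns-typeII-p2).  After `…EnergySaturationSlowRate` (`0 < g < 2/5`), `…ZeroRate` (`g = 0`) and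
ns-ezl-w7's `…NegRate` (`g < 0`), the power-clock residue of the weak class is the window `g ∈ [2/5, 1/(2+ρ)]`, where the scale ODE
`(R^κ J)' = g⁻¹R^{κ−1}F` (`J(R) = ∫σ(R⁻¹y)|V|²`, `κ = 2/g − 5 ∈ (−1, 0]`) has the NON-DECAYING homogeneous solution `R^{−κ} = R^{5−2/g}` — the clock's
OWN-RATE extremal growth, compatible with the class bound `R^{1−2ρ}`.  This file supplies the census form «vanish OR saturate the own rate»:

* `ownRate_leftStep` — FROM THE LEFT (any rate `g > 0`, any `δ > 0`): `J ≤ C R^m` on `[L₁,∞)` ⇒ `J ≤ C' R^{max(m/2 − 5ρ/4, −κ + δ)}` (the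
  `slowRate_step` of `…SlowRate` with the floor `−κ/2` replaced by `−κ + δ`; comparison with `(B/(gν))R^ν`, `ν = κ + max(…) ≥ δ > 0`);
* `ownRate_infStep` — FROM INFINITY under OWN-RATE SUB-EXTREMALITY along a sequence (`R^κ J(R) < ε` beyond every `L₀`): if `κ + (m/2 − 5ρ/4) < 0`
  then `J ≤ C R^m ⇒ J ≤ C' R^{m/2 − 5ρ/4}` with NO floor (`Ψ = R^κJ + (B/(gν))R^ν`, `ν < 0`, is non-decreasing and `< ε` far out, hence `≤ 0`);
* `ownRate_iterate` — from `m₀ = 1 − 2ρ`: while `m ≥ 0`, the applicable step loses at least `5ρ/8`; finitely many steps reach `m < 0`.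

WHAT THIS IS NOT: not NS regularity, not the crux — pure real-analysis lemmas for the census form of one residue of the crux CLASS 19832 on the MODEL
lattice (`--supports` stmt-19832). [folklore; cf. BronziShvydkoy2015 Thm 1.1, ChaeShvydkoy2013 §2.2 (2.12)]
-/

noncomputable section

-- flat `Theorems/<Route><Decl>…` files of one crux share the namespace of the crux (tree convention: `Summit.<S>.<S>.…`)
set_option linter.dupNamespace false

open Set Filter Topology
open scoped NNReal

namespace Summit.NavierStokesRegularity.NavierStokesRegularity.Theorems.PowerGaugeEulerLiouville

namespace EnergySaturation

variable {ρ g : ℝ} {c : ℝ≥0} {A : ℝ} {J F : ℝ → ℝ}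

/-- **The pointwise flux bound from an admissible power bound** (shared by both steps): under the flux bound through the tail supremum, `J ≤ C R^m` on
`[L₁,∞)` with `m ≤ 1−2ρ` and admissible tail suprema gives `|F r| ≤ (A C^{1/2}/(2+ρ)) r^{m/2 − 5ρ/4}` on `[L₁,∞)`. [folklore] -/
theorem abs_flux_le_rpow_of_bound (hρ : 0 < ρ)
    (hflux : ∀ S : ℝ, 0 ≤ S → S ≤ 3 * c → ∀ L : ℝ, 1 ≤ L →
      (∀ R : ℝ, L ≤ R → J R ≤ R ^ (1 - 2 * ρ) * S) →
      ∀ r : ℝ, L ≤ r → |(2 + ρ) * r ^ (2 * ρ - 2) * F r| ≤ A * S ^ (1 / 2 : ℝ) * r ^ (-1 - (2 + ρ) / 4))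
    {m C L₁ : ℝ} (hm : m ≤ 1 - 2 * ρ) (hC : 0 ≤ C) (hL₁ : 1 ≤ L₁)
    (hbound : ∀ R : ℝ, L₁ ≤ R → J R ≤ C * R ^ m)
    (h3c : ∀ r : ℝ, L₁ ≤ r → C * r ^ (m - (1 - 2 * ρ)) ≤ 3 * c) :
    ∀ r : ℝ, L₁ ≤ r → |F r| ≤ A * C ^ (1 / 2 : ℝ) / (2 + ρ) * r ^ (m / 2 - 5 * ρ / 4) := by
  -- adapted from `slowRate_step` (…EnergySaturationSlowRate), step (1)
  have h2ρ : 0 < 2 + ρ := by linarith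
  intro r hr
  have hr1 : 1 ≤ r := hL₁.trans hr
  have hr0 : 0 < r := lt_of_lt_of_le one_pos hr1
  set S : ℝ := C * r ^ (m - (1 - 2 * ρ)) with hS
  have hS0 : 0 ≤ S := by rw [hS]; exact mul_nonneg hC (Real.rpow_nonneg hr0.le _)
  have hS3 : S ≤ 3 * c := h3c r hr
  have htail : ∀ R : ℝ, r ≤ R → J R ≤ R ^ (1 - 2 * ρ) * S := by
    intro R hR
    have hR0 : 0 < R := lt_of_lt_of_le hr0 hR
    have hRr : R ^ (m - (1 - 2 * ρ)) ≤ r ^ (m - (1 - 2 * ρ)) :=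
      Real.rpow_le_rpow_of_nonpos hr0 hR (by linarith)
    have hsplit : C * R ^ m = R ^ (1 - 2 * ρ) * (C * R ^ (m - (1 - 2 * ρ))) := by
      have : R ^ m = R ^ (1 - 2 * ρ) * R ^ (m - (1 - 2 * ρ)) := by
        rw [← Real.rpow_add hR0]; ring_nf
      rw [this]; ring
    calc J R ≤ C * R ^ m := hbound R (hr.trans hR)
      _ = R ^ (1 - 2 * ρ) * (C * R ^ (m - (1 - 2 * ρ))) := hsplit
      _ ≤ R ^ (1 - 2 * ρ) * S := by
          rw [hS]
          exact mul_le_mul_of_nonneg_left (mul_le_mul_of_nonneg_left hRr hC) (Real.rpow_nonneg hR0.le _)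
  have hfl := hflux S hS0 hS3 r hr1 htail r le_rfl
  have hw0 : 0 < (2 + ρ) * r ^ (2 * ρ - 2) := mul_pos h2ρ (Real.rpow_pos_of_pos hr0 _)
  rw [abs_mul, abs_of_pos hw0] at hfl
  have hS12 : S ^ (1 / 2 : ℝ) = C ^ (1 / 2 : ℝ) * r ^ ((m - (1 - 2 * ρ)) / 2) := by
    rw [hS, Real.mul_rpow hC (Real.rpow_nonneg hr0.le _), ← Real.rpow_mul hr0.le]
    congr 1; ring_nf
  have hkey : |F r| ≤ (A * S ^ (1 / 2 : ℝ) * r ^ (-1 - (2 + ρ) / 4)) / ((2 + ρ) * r ^ (2 * ρ - 2)) := by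
    rw [le_div_iff₀ hw0]
    calc |F r| * ((2 + ρ) * r ^ (2 * ρ - 2)) = (2 + ρ) * r ^ (2 * ρ - 2) * |F r| := by ring
      _ ≤ A * S ^ (1 / 2 : ℝ) * r ^ (-1 - (2 + ρ) / 4) := hfl
  refine hkey.trans (le_of_eq ?_)
  rw [hS12, div_eq_iff hw0.ne']
  have hpow : r ^ ((m - (1 - 2 * ρ)) / 2) * r ^ (-1 - (2 + ρ) / 4) = r ^ (m / 2 - 5 * ρ / 4) * r ^ (2 * ρ - 2) := by
    rw [← Real.rpow_add hr0, ← Real.rpow_add hr0]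
    congr 1; ring
  calc A * (C ^ (1 / 2 : ℝ) * r ^ ((m - (1 - 2 * ρ)) / 2)) * r ^ (-1 - (2 + ρ) / 4)
      = A * C ^ (1 / 2 : ℝ) * (r ^ ((m - (1 - 2 * ρ)) / 2) * r ^ (-1 - (2 + ρ) / 4)) := by ring
    _ = A * C ^ (1 / 2 : ℝ) * (r ^ (m / 2 - 5 * ρ / 4) * r ^ (2 * ρ - 2)) := by rw [hpow]
    _ = A * C ^ (1 / 2 : ℝ) / (2 + ρ) * r ^ (m / 2 - 5 * ρ / 4) * ((2 + ρ) * r ^ (2 * ρ - 2)) := by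
        field_simp

/-- **OWN-RATE STEP FROM THE LEFT** (any rate `g > 0`, any floor margin `δ > 0`).  `J ≥ 0`; flux bound through the tail supremum (data exponent `ρ`);
scale ODE `(R^{2/g−5} J)' = g⁻¹ R^{2/g−6} F`.  If `J ≤ C R^m` on `[L₁,∞)` (`m ≤ 1−2ρ`, admissible), then `J ≤ C' R^{max(m/2 − 5ρ/4, −(2/g−5) + δ)}` on
`[L₁,∞)`. [folklore] -/
theorem ownRate_leftStep (hρ : 0 < ρ) (hg0 : 0 < g) {δ : ℝ} (hδ : 0 < δ) (hA0 : 0 ≤ A)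
    (hJ0 : ∀ R : ℝ, 0 < R → 0 ≤ J R)
    (hflux : ∀ S : ℝ, 0 ≤ S → S ≤ 3 * c → ∀ L : ℝ, 1 ≤ L →
      (∀ R : ℝ, L ≤ R → J R ≤ R ^ (1 - 2 * ρ) * S) →
      ∀ r : ℝ, L ≤ r → |(2 + ρ) * r ^ (2 * ρ - 2) * F r| ≤ A * S ^ (1 / 2 : ℝ) * r ^ (-1 - (2 + ρ) / 4))
    (hderiv : ∀ r : ℝ, 0 < r →
      HasDerivAt (fun L : ℝ => L ^ (2 / g - 5) * J L) (g⁻¹ * r ^ (2 / g - 6) * F r) r)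
    {m C L₁ : ℝ} (hm : m ≤ 1 - 2 * ρ) (hC : 0 ≤ C) (hL₁ : 1 ≤ L₁)
    (hbound : ∀ R : ℝ, L₁ ≤ R → J R ≤ C * R ^ m)
    (h3c : ∀ r : ℝ, L₁ ≤ r → C * r ^ (m - (1 - 2 * ρ)) ≤ 3 * c) :
    ∃ C' : ℝ, 0 ≤ C' ∧ ∀ R : ℝ, L₁ ≤ R →
      J R ≤ C' * R ^ max (m / 2 - 5 * ρ / 4) (-(2 / g - 5) + δ) := by
  -- adapted from `slowRate_step` (…EnergySaturationSlowRate): floor `−κ/2 ↦ −κ + δ`, ODE coefficient `(2+ρ') ↦ g⁻¹`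
  have h2ρ : 0 < 2 + ρ := by linarith
  have hL₁0 : 0 < L₁ := lt_of_lt_of_le one_pos hL₁
  set κ : ℝ := 2 / g - 5 with hκ
  set μ : ℝ := m / 2 - 5 * ρ / 4 with hμ
  set mp : ℝ := max μ (-κ + δ) with hmp
  set ν : ℝ := κ + mp with hν
  have hν0 : 0 < ν := by
    have : -κ + δ ≤ mp := le_max_right _ _
    rw [hν]; linarith
  have hκμν : κ + μ ≤ ν := by
    have : μ ≤ mp := le_max_left _ _
    rw [hν]; linarith
  set B : ℝ := A * C ^ (1 / 2 : ℝ) / (2 + ρ) with hB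
  have hB0 : 0 ≤ B := by rw [hB]; positivity
  have hFle : ∀ r : ℝ, L₁ ≤ r → |F r| ≤ B * r ^ μ :=
    abs_flux_le_rpow_of_bound hρ hflux hm hC hL₁ hbound h3c
  -- comparison: `Φ(R) = R^κ J(R) − (B/(gν)) R^ν` is non-increasing on `[L₁, ∞)`
  set Φ : ℝ → ℝ := fun R => R ^ κ * J R - B / g / ν * R ^ ν with hΦ
  have hΦderiv : ∀ r : ℝ, L₁ ≤ r →
      HasDerivAt Φ (g⁻¹ * r ^ (2 / g - 6) * F r - B / g * r ^ (ν - 1)) r := by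
    intro r hr
    have hr0 : 0 < r := lt_of_lt_of_le hL₁0 hr
    have h1 : HasDerivAt (fun L : ℝ => L ^ κ * J L) (g⁻¹ * r ^ (2 / g - 6) * F r) r := hderiv r hr0
    have h2 : HasDerivAt (fun L : ℝ => B / g / ν * L ^ ν) (B / g * r ^ (ν - 1)) r := by
      have h := (Real.hasDerivAt_rpow_const (x := r) (p := ν) (Or.inl hr0.ne')).const_mul (B / g / ν)
      have hνne : ν ≠ 0 := hν0.ne'
      have e : B / g / ν * (ν * r ^ (ν - 1)) = B / g * r ^ (ν - 1) := by
        field_simp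
      rw [e] at h
      exact h
    have h := h1.sub h2
    simp only [hΦ]
    convert h using 1 <;> rfl
  have hΦ'le : ∀ r : ℝ, L₁ ≤ r → g⁻¹ * r ^ (2 / g - 6) * F r - B / g * r ^ (ν - 1) ≤ 0 := by
    intro r hr
    have hr1 : 1 ≤ r := hL₁.trans hr
    have hr0 : 0 < r := lt_of_lt_of_le one_pos hr1
    have hF := hFle r hr
    have hw : 0 ≤ g⁻¹ * r ^ (2 / g - 6) := mul_nonneg (inv_nonneg.2 hg0.le) (Real.rpow_nonneg hr0.le _)
    have h1 : g⁻¹ * r ^ (2 / g - 6) * F r ≤ g⁻¹ * r ^ (2 / g - 6) * (B * r ^ μ) :=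
      mul_le_mul_of_nonneg_left ((le_abs_self _).trans hF) hw
    have h2 : r ^ (2 / g - 6) * r ^ μ ≤ r ^ (ν - 1) := by
      rw [← Real.rpow_add hr0]
      exact Real.rpow_le_rpow_of_exponent_le hr1 (by rw [hκ] at hκμν; linarith)
    have h3 : g⁻¹ * r ^ (2 / g - 6) * (B * r ^ μ) ≤ B / g * r ^ (ν - 1) := by
      calc g⁻¹ * r ^ (2 / g - 6) * (B * r ^ μ) = B / g * (r ^ (2 / g - 6) * r ^ μ) := by rw [div_eq_mul_inv]; ring
        _ ≤ B / g * r ^ (ν - 1) := mul_le_mul_of_nonneg_left h2 (by positivity)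
    linarith
  have hΦanti : AntitoneOn Φ (Ici L₁) := by
    have hcont : ContinuousOn Φ (Ici L₁) := fun r hr =>
      (hΦderiv r (mem_Ici.1 hr)).continuousAt.continuousWithinAt
    have hdiff : DifferentiableOn ℝ Φ (interior (Ici L₁)) := by
      rw [interior_Ici]
      exact fun r hr => (hΦderiv r (le_of_lt (mem_Ioi.1 hr))).differentiableAt.differentiableWithinAt
    refine antitoneOn_of_deriv_nonpos (convex_Ici L₁) hcont hdiff fun r hr => ?_
    rw [interior_Ici] at hr
    have hr' : L₁ ≤ r := le_of_lt (mem_Ioi.1 hr)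
    rw [(hΦderiv r hr').deriv]
    exact hΦ'le r hr'
  set C' : ℝ := L₁ ^ κ * J L₁ + B / g / ν with hC'
  have hC'0 : 0 ≤ C' := by
    rw [hC']
    exact add_nonneg (mul_nonneg (Real.rpow_nonneg hL₁0.le _) (hJ0 L₁ hL₁0)) (by positivity)
  refine ⟨C', hC'0, fun R hR => ?_⟩
  have hR1 : 1 ≤ R := hL₁.trans hR
  have hR0 : 0 < R := lt_of_lt_of_le one_pos hR1
  have hΦle : Φ R ≤ Φ L₁ := hΦanti (mem_Ici.2 le_rfl) (mem_Ici.2 hR) hR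
  have hRν1 : 1 ≤ R ^ ν := Real.one_le_rpow hR1 hν0.le
  have hL₁ν : 0 ≤ B / g / ν * L₁ ^ ν := by positivity
  have hRκJ : R ^ κ * J R ≤ C' * R ^ ν := by
    have h1 : R ^ κ * J R ≤ L₁ ^ κ * J L₁ + B / g / ν * R ^ ν := by
      have := hΦle
      simp only [hΦ] at this
      linarith
    have h2 : L₁ ^ κ * J L₁ ≤ L₁ ^ κ * J L₁ * R ^ ν := by
      have h0 : 0 ≤ L₁ ^ κ * J L₁ := mul_nonneg (Real.rpow_nonneg hL₁0.le _) (hJ0 L₁ hL₁0)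
      nlinarith
    calc R ^ κ * J R ≤ L₁ ^ κ * J L₁ + B / g / ν * R ^ ν := h1
      _ ≤ L₁ ^ κ * J L₁ * R ^ ν + B / g / ν * R ^ ν := by linarith
      _ = C' * R ^ ν := by rw [hC']; ring
  have hRκ0 : 0 < R ^ κ := Real.rpow_pos_of_pos hR0 _
  have hνκ : R ^ ν = R ^ κ * R ^ mp := by
    rw [← Real.rpow_add hR0, hν]
  rw [hνκ] at hRκJ
  have : R ^ κ * J R ≤ R ^ κ * (C' * R ^ mp) := by
    calc R ^ κ * J R ≤ C' * (R ^ κ * R ^ mp) := hRκJ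
      _ = R ^ κ * (C' * R ^ mp) := by ring
  exact le_of_mul_le_mul_left this hRκ0

/-- **OWN-RATE STEP FROM INFINITY UNDER SUB-EXTREMALITY** (rate `g > 0`).  Flux bound through the tail supremum; scale ODE at rate `g`;
the normalised own-rate energy dips below every `ε` beyond every scale: `∀ ε > 0, ∀ L₀, ∃ L ≥ L₀, L^{2/g−5} J(L) < ε`.  If `J ≤ C R^m` on `[L₁,∞)`
(`m ≤ 1−2ρ`, admissible) and `(2/g − 5) + (m/2 − 5ρ/4) < 0`, then `J ≤ C' R^{m/2 − 5ρ/4}` on `[L₁,∞)`. [folklore] -/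
theorem ownRate_infStep (hρ : 0 < ρ) (hg0 : 0 < g) (hA0 : 0 ≤ A)
    (hflux : ∀ S : ℝ, 0 ≤ S → S ≤ 3 * c → ∀ L : ℝ, 1 ≤ L →
      (∀ R : ℝ, L ≤ R → J R ≤ R ^ (1 - 2 * ρ) * S) →
      ∀ r : ℝ, L ≤ r → |(2 + ρ) * r ^ (2 * ρ - 2) * F r| ≤ A * S ^ (1 / 2 : ℝ) * r ^ (-1 - (2 + ρ) / 4))
    (hderiv : ∀ r : ℝ, 0 < r →
      HasDerivAt (fun L : ℝ => L ^ (2 / g - 5) * J L) (g⁻¹ * r ^ (2 / g - 6) * F r) r)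
    (hsub : ∀ ε : ℝ, 0 < ε → ∀ L₀ : ℝ, ∃ L : ℝ, L₀ ≤ L ∧ L ^ (2 / g - 5) * J L < ε)
    {m C L₁ : ℝ} (hm : m ≤ 1 - 2 * ρ) (hC : 0 ≤ C) (hL₁ : 1 ≤ L₁)
    (hbound : ∀ R : ℝ, L₁ ≤ R → J R ≤ C * R ^ m)
    (h3c : ∀ r : ℝ, L₁ ≤ r → C * r ^ (m - (1 - 2 * ρ)) ≤ 3 * c)
    (hκμ : (2 / g - 5) + (m / 2 - 5 * ρ / 4) < 0) :
    ∃ C' : ℝ, 0 ≤ C' ∧ ∀ R : ℝ, L₁ ≤ R → J R ≤ C' * R ^ (m / 2 - 5 * ρ / 4) := by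
  have h2ρ : 0 < 2 + ρ := by linarith
  have hL₁0 : 0 < L₁ := lt_of_lt_of_le one_pos hL₁
  set κ : ℝ := 2 / g - 5 with hκ
  set μ : ℝ := m / 2 - 5 * ρ / 4 with hμ
  set ν : ℝ := κ + μ with hν
  have hν0 : ν < 0 := by rw [hν]; exact hκμ
  set B : ℝ := A * C ^ (1 / 2 : ℝ) / (2 + ρ) with hB
  have hB0 : 0 ≤ B := by rw [hB]; positivity
  have hFle : ∀ r : ℝ, L₁ ≤ r → |F r| ≤ B * r ^ μ :=
    abs_flux_le_rpow_of_bound hρ hflux hm hC hL₁ hbound h3c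
  -- comparison from infinity: `Ψ(R) = R^κ J(R) + (B/(gν)) R^ν` is non-decreasing on `[L₁, ∞)` and `< ε` beyond every scale
  set Ψ : ℝ → ℝ := fun R => R ^ κ * J R + B / g / ν * R ^ ν with hΨ
  have hΨderiv : ∀ r : ℝ, L₁ ≤ r →
      HasDerivAt Ψ (g⁻¹ * r ^ (2 / g - 6) * F r + B / g * r ^ (ν - 1)) r := by
    intro r hr
    have hr0 : 0 < r := lt_of_lt_of_le hL₁0 hr
    have h1 : HasDerivAt (fun L : ℝ => L ^ κ * J L) (g⁻¹ * r ^ (2 / g - 6) * F r) r := hderiv r hr0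
    have h2 : HasDerivAt (fun L : ℝ => B / g / ν * L ^ ν) (B / g * r ^ (ν - 1)) r := by
      have h := (Real.hasDerivAt_rpow_const (x := r) (p := ν) (Or.inl hr0.ne')).const_mul (B / g / ν)
      have hνne : ν ≠ 0 := hν0.ne
      have e : B / g / ν * (ν * r ^ (ν - 1)) = B / g * r ^ (ν - 1) := by
        field_simp
      rw [e] at h
      exact h
    have h := h1.add h2
    simp only [hΨ]
    convert h using 1 <;> rfl
  have hΨ'ge : ∀ r : ℝ, L₁ ≤ r → 0 ≤ g⁻¹ * r ^ (2 / g - 6) * F r + B / g * r ^ (ν - 1) := by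
    intro r hr
    have hr1 : 1 ≤ r := hL₁.trans hr
    have hr0 : 0 < r := lt_of_lt_of_le one_pos hr1
    have hF := hFle r hr
    have hw : 0 ≤ g⁻¹ * r ^ (2 / g - 6) := mul_nonneg (inv_nonneg.2 hg0.le) (Real.rpow_nonneg hr0.le _)
    have hFge : -(B * r ^ μ) ≤ F r := by
      have := neg_abs_le (F r)
      linarith
    have h1 := mul_le_mul_of_nonneg_left hFge hw
    have h2 : g⁻¹ * r ^ (2 / g - 6) * (B * r ^ μ) = B / g * r ^ (ν - 1) := by
      have : r ^ (2 / g - 6) * r ^ μ = r ^ (ν - 1) := by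
        rw [← Real.rpow_add hr0, hν, hκ]; congr 1; ring
      rw [← this, div_eq_mul_inv]; ring
    rw [mul_neg, h2] at h1
    linarith
  have hΨmono : MonotoneOn Ψ (Ici L₁) := by
    have hcont : ContinuousOn Ψ (Ici L₁) := fun r hr =>
      (hΨderiv r (mem_Ici.1 hr)).continuousAt.continuousWithinAt
    have hdiff : DifferentiableOn ℝ Ψ (interior (Ici L₁)) := by
      rw [interior_Ici]
      exact fun r hr => (hΨderiv r (le_of_lt (mem_Ioi.1 hr))).differentiableAt.differentiableWithinAt
    refine monotoneOn_of_deriv_nonneg (convex_Ici L₁) hcont hdiff fun r hr => ?_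
    rw [interior_Ici] at hr
    have hr' : L₁ ≤ r := le_of_lt (mem_Ioi.1 hr)
    rw [(hΨderiv r hr').deriv]
    exact hΨ'ge r hr'
  -- hence `Ψ ≤ 0` on `[L₁, ∞)`
  have hΨle : ∀ R : ℝ, L₁ ≤ R → Ψ R ≤ 0 := by
    intro R hR
    refine le_of_forall_pos_lt_add fun ε hε => ?_
    obtain ⟨L, hLR, hLε⟩ := hsub ε hε R
    have hL0 : 0 < L := hL₁0.trans_le (hR.trans hLR)
    have hmono := hΨmono (mem_Ici.2 hR) (mem_Ici.2 (hR.trans hLR)) hLR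
    have hneg : B / g / ν * L ^ ν ≤ 0 :=
      mul_nonpos_of_nonpos_of_nonneg (div_nonpos_of_nonneg_of_nonpos (by positivity) hν0.le) (Real.rpow_nonneg hL0.le _)
    have : Ψ L < ε := by
      simp only [hΨ]
      linarith
    linarith
  refine ⟨B / g / (-ν), by
    have : 0 < -ν := by linarith
    positivity, fun R hR => ?_⟩
  have hR0 : 0 < R := lt_of_lt_of_le hL₁0 hR
  have hRκ0 : 0 < R ^ κ := Real.rpow_pos_of_pos hR0 _
  have h1 : R ^ κ * J R ≤ B / g / (-ν) * R ^ ν := by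
    have : R ^ κ * J R + B / g / ν * R ^ ν ≤ 0 := by simpa only [hΨ] using hΨle R hR
    have e : B / g / (-ν) * R ^ ν = -(B / g / ν * R ^ ν) := by
      rw [div_neg]; ring
    rw [e]; linarith
  have hνκ : R ^ ν = R ^ κ * R ^ μ := by
    rw [← Real.rpow_add hR0, hν]
  rw [hνκ] at h1
  have : R ^ κ * J R ≤ R ^ κ * (B / g / (-ν) * R ^ μ) := by
    calc R ^ κ * J R ≤ B / g / (-ν) * (R ^ κ * R ^ μ) := h1
      _ = R ^ κ * (B / g / (-ν) * R ^ μ) := by ring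
  exact le_of_mul_le_mul_left this hRκ0

/-- **THE OWN-RATE ITERATION** (`c > 0`, any rate `g > 0`; meant for `2/5 ≤ g ≤ ½`, `κ = 2/g − 5 ∈ [−1, 0]`): from the base bound `J(R) ≤ C₀ R^{1−2ρ}` on `[1,∞)`
(`C₀ ≤ 3c`) and own-rate sub-extremality along a sequence, there are `m < 0`, `C ≥ 0`, `L₁ ≥ 1` with `J(R) ≤ C R^m` on `[L₁,∞)`.  While `m ≥ 0`: if
`κ + (m/2 − 5ρ/4) < 0` the step from infinity loses `≥ 5ρ/4`; otherwise the step from the left with `δ = 5ρ/8` loses `≥ 5ρ/8`. [folklore] -/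
theorem ownRate_iterate (hρ : 0 < ρ) (hg0 : 0 < g) (hc : 0 < (c : ℝ)) (hA0 : 0 ≤ A)
    (hJ0 : ∀ R : ℝ, 0 < R → 0 ≤ J R)
    (hflux : ∀ S : ℝ, 0 ≤ S → S ≤ 3 * c → ∀ L : ℝ, 1 ≤ L →
      (∀ R : ℝ, L ≤ R → J R ≤ R ^ (1 - 2 * ρ) * S) →
      ∀ r : ℝ, L ≤ r → |(2 + ρ) * r ^ (2 * ρ - 2) * F r| ≤ A * S ^ (1 / 2 : ℝ) * r ^ (-1 - (2 + ρ) / 4))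
    (hderiv : ∀ r : ℝ, 0 < r →
      HasDerivAt (fun L : ℝ => L ^ (2 / g - 5) * J L) (g⁻¹ * r ^ (2 / g - 6) * F r) r)
    (hsub : ∀ ε : ℝ, 0 < ε → ∀ L₀ : ℝ, ∃ L : ℝ, L₀ ≤ L ∧ L ^ (2 / g - 5) * J L < ε)
    {C₀ : ℝ} (hC₀ : 0 ≤ C₀) (hC₀3 : C₀ ≤ 3 * c)
    (hbase : ∀ R : ℝ, 1 ≤ R → J R ≤ C₀ * R ^ (1 - 2 * ρ)) :
    ∃ m C L₁ : ℝ, m < 0 ∧ 0 ≤ C ∧ 1 ≤ L₁ ∧ ∀ R : ℝ, L₁ ≤ R → J R ≤ C * R ^ m := by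
  set κ : ℝ := 2 / g - 5 with hκ
  set d : ℝ := 5 * ρ / 8 with hd
  have hd0 : 0 < d := by rw [hd]; positivity
  -- one step: from an admissible bound with `0 ≤ m ≤ 1−2ρ` to a bound with exponent `≤ m − d`
  have hstep : ∀ m C L₁ : ℝ, 0 ≤ m → m ≤ 1 - 2 * ρ → 0 ≤ C → 1 ≤ L₁ →
      (∀ R : ℝ, L₁ ≤ R → J R ≤ C * R ^ m) → (∀ r : ℝ, L₁ ≤ r → C * r ^ (m - (1 - 2 * ρ)) ≤ 3 * c) →
      ∃ m' C' : ℝ, m' ≤ m - d ∧ 0 ≤ C' ∧ ∀ R : ℝ, L₁ ≤ R → J R ≤ C' * R ^ m' := by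
    intro m C L₁ hm0 hm hC hL₁ hb h3c
    by_cases hcase : κ + (m / 2 - 5 * ρ / 4) < 0
    · obtain ⟨C', hC'0, hb'⟩ := ownRate_infStep hρ hg0 hA0 hflux hderiv hsub hm hC hL₁ hb h3c hcase
      refine ⟨m / 2 - 5 * ρ / 4, C', ?_, hC'0, hb'⟩
      rw [hd]; linarith
    · push Not at hcase
      obtain ⟨C', hC'0, hb'⟩ := ownRate_leftStep hρ hg0 hd0 hA0 hJ0 hflux hderiv hm hC hL₁ hb h3c
      refine ⟨max (m / 2 - 5 * ρ / 4) (-(2 / g - 5) + d), C', ?_, hC'0, hb'⟩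
      refine max_le ?_ ?_
      · rw [hd]; linarith
      · rw [hκ] at hcase; rw [hd]; linarith
  have hQ : ∀ k : ℕ, ∃ m C L₁ : ℝ, 0 ≤ C ∧ 1 ≤ L₁ ∧ (∀ R : ℝ, L₁ ≤ R → J R ≤ C * R ^ m) ∧
      (m < 0 ∨ (m ≤ 1 - 2 * ρ - k * d ∧ m ≤ 1 - 2 * ρ ∧
        ∀ r : ℝ, L₁ ≤ r → C * r ^ (m - (1 - 2 * ρ)) ≤ 3 * c)) := by
    intro k
    induction k with
    | zero =>
      refine ⟨1 - 2 * ρ, C₀, 1, hC₀, le_rfl, hbase, Or.inr ⟨by simp, le_rfl, fun r hr => ?_⟩⟩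
      rw [sub_self, Real.rpow_zero, mul_one]
      exact hC₀3
    | succ k ih =>
      obtain ⟨m, C, L₁, hC, hL₁, hb, hcase⟩ := ih
      rcases hcase with hneg | ⟨hmk, hm, h3c⟩
      · exact ⟨m, C, L₁, hC, hL₁, hb, Or.inl hneg⟩
      by_cases hm0 : m < 0
      · exact ⟨m, C, L₁, hC, hL₁, hb, Or.inl hm0⟩
      push Not at hm0
      obtain ⟨mp, C', hmp, hC'0, hb'⟩ := hstep m C L₁ hm0 hm hC hL₁ hb h3c
      by_cases hmp0 : mp < 0
      · exact ⟨mp, C', L₁, hC'0, hL₁, hb', Or.inl hmp0⟩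
      push Not at hmp0
      have hmp_k : mp ≤ 1 - 2 * ρ - (↑(k + 1) : ℝ) * d := by
        push_cast; linarith
      have hmp_le : mp ≤ 1 - 2 * ρ := by linarith
      have hexp : mp - (1 - 2 * ρ) < 0 := by linarith
      have htend : Tendsto (fun r : ℝ => C' * r ^ (mp - (1 - 2 * ρ))) atTop (𝓝 (C' * 0)) := by
        refine tendsto_const_nhds.mul ?_
        have := tendsto_rpow_neg_atTop (y := -(mp - (1 - 2 * ρ))) (by linarith)
        simpa using this
      rw [mul_zero] at htend
      have h3c0 : (0 : ℝ) < 3 * c := by positivity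
      obtain ⟨L₂, hL₂δ, hL₂ge⟩ :=
        ((htend.eventually (gt_mem_nhds h3c0)).and (eventually_ge_atTop L₁)).exists
      have hL₂1 : 1 ≤ L₂ := hL₁.trans hL₂ge
      have hL₂0 : 0 < L₂ := lt_of_lt_of_le one_pos hL₂1
      refine ⟨mp, C', L₂, hC'0, hL₂1, fun R hR => hb' R (hL₂ge.trans hR), Or.inr ⟨hmp_k, hmp_le, fun r hr => ?_⟩⟩
      have hr0 : 0 < r := lt_of_lt_of_le hL₂0 hr
      have hmono : r ^ (mp - (1 - 2 * ρ)) ≤ L₂ ^ (mp - (1 - 2 * ρ)) :=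
        Real.rpow_le_rpow_of_nonpos hL₂0 hr hexp.le
      calc C' * r ^ (mp - (1 - 2 * ρ)) ≤ C' * L₂ ^ (mp - (1 - 2 * ρ)) := mul_le_mul_of_nonneg_left hmono hC'0
        _ ≤ 3 * c := hL₂δ.le
  obtain ⟨k, hk⟩ := exists_nat_gt ((1 - 2 * ρ) / d)
  obtain ⟨m, C, L₁, hC, hL₁, hb, hcase⟩ := hQ k
  have hmneg : m < 0 := by
    rcases hcase with h | ⟨hmk, -, -⟩
    · exact h
    · have : (1 - 2 * ρ) < k * d := by rwa [div_lt_iff₀ hd0] at hk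
      linarith
  exact ⟨m, C, L₁, hmneg, hC, hL₁, hb⟩

end EnergySaturation

end Summit.NavierStokesRegularity.NavierStokesRegularity.Theorems.PowerGaugeEulerLiouville

end
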